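import Summits.BirchSwinnertonDyer.BirchSwinnertonDyer.Theses.KatoDescentPotSupersingular
import Summits.BirchSwinnertonDyer.BirchSwinnertonDyer.Theorems.KatoDescentPotSupersingularWildJetchevBoundAtPOfStubs
import Summits.BirchSwinnertonDyer.BirchSwinnertonDyer.Theorems.KatoDescentPotSupersingularWildJetchevBoundAtPCoreVertexBridgePrimed
import Summits.BirchSwinnertonDyer.BirchSwinnertonDyer.Theorems.Rank1ResidualJetRingClassFields
import HarnessLib

/-! **ARCHIVE** — skeleton v3 (plan g22, sha 805451dd0dcc) ARCHIVED by plan g23 at the v4 adoption; namespace renamed `.BirthV3`; not registered, history only. -/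

/-!
**ADOPTED as skeleton v3 by planner bsd-potss-plan g22 (2026-08-27T11:0xZ)** — k9-c4 g8's candidate v2.1 byte-identical below this note. Supersedes the registered v2 (sha f44935873f05 @ 6bdfe1cb47dc, archived `Lines/v2_S2p_g8.lean`, ns `.BirthV2`): v2's XL stub `stub_divisibilityAtP` (S2p) is now PROVED inside the skeleton (`S2pDivisibilityAtP_of`, via p522249/p520230) from 20165 v5's registered stubs `stub_prop52IrredP` / `stub_coreVertexExistenceIrredP` / `stub_prop44Irred` (byte-identical Sig bodies — ONE proof closes the stub on both items) + the one 19941-specific statement `stub_thm52KernelGapsAtP` (hardest; = 20165's `stub_thm52KernelGapsAddv` with the carrier at p). Seven stubs (= stubs_max; five shared with 20165, one held alias, one idle supplement). The crux is NOT restated this generation (binder `NumberField.discr K ≠ -4` queued for the next serialised K9 edit — TARGET R183; then `stub_gaussianSupplement` drops).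

# BC3 SKELETON v2.1 (CANDIDATE, prover-written for the planner; v2 + 20165 v4/v5 alignment: Čebotarev stub dropped, readings PRIMED) — crux `WildJetchevBoundAtP` (item
# stmt-BirchSwinnertonDyer-19941; route K9 = `Theses/KatoDescentPotSupersingular.lean`, rank 6); seat `bsd-potss-k9-c4` g8,
# 2026-08-27; supersedes v1 (`Lines/birth.lean` fa288a46e054: S1′ `stub_structure_depth_indexForm_d3` / S2′
# `stub_derivedPoint_divisible_at_additive_p`) IF the planner adopts it (only the planner's unit may `crux write`)

WHY v2. Three kernel files of k9-c4 g8 (all ACCEPTED, route-free except the first which imports the K9 route for the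
by-name §3): p518161 `…WildJetchevBoundAtPOfStubs` (the crux BY NAME from S1 + S2p + `PublishedInputsHeegner` + the
displayed `d_K = −4` supplement), p518685 `…WildJetchevBoundAtPSkeletonRekey` (v1's S1′/S2′ at `d_K ≠ −4` ⟸ S1 / S2p),
p520230 `…WildJetchevBoundAtPCoreVertexBridge` (S2p ⟸ prop52Irred + coreVertexExistenceIrred + hRCF + H63Ip; H63Ip ⟸
cor32Irred + prop44Irred + KernelGapsAtP, via k8t-c4's carrier-abstract assembly p508713 at `t := ord_p c_p`). So the
crux REDUCES to the shared crux 20165's registered stubs (skeleton v3: `stub_structureIrred`, `stub_prop52Irred`,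
`stub_coreVertexExistenceIrred`, `stub_cor32Irred`, `stub_prop44Irred` — VERBATIM, same `Sig` bodies; a proof of any
of them for 20165 is a proof here) + ONE new statement `stub_thm52KernelGapsAtP` (20165's `stub_thm52KernelGapsAddv`
with the carrier moved to `p`) + the held `PublishedInputsHeegner` + the idle Gaussian-field supplement
`stub_gaussianSupplement` (the crux body at `d_K = −4`; DROP IT by adding the binder `NumberField.discr K ≠ -4` to the
crux — its one consumer, the J08 road, applies `hJp` at a BFH field with `d_K < −4`; then this skeleton has exactly
20165's seven stub slots). READING behind the cut (FINDING-19941 memo): the `q = p` carrier is bsd-jet's road K4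
`JET.JetchevDivisibilityCarrierAdd` read with `E[p]` irreducible; Jetchev's Lemma 4.3 at `v ∣ p` is replaced by
x11b3's connected-Kummer layer theorem mod [GZ III (3.1)], the Thm 6.3 local quotient is `Φ_v(𝔽_p)/p^m`; §§5–6 are
carrier-blind — so 19941 is NOT beyond Jetchev's method, it is the B-row instance of the same reading as 20165.
v2.1: `stub_cor32Irred` DROPPED (k8t-c4 g9: h32I false as displayed, its row form a THEOREM p516209; Čebotarev-free assembly p519470) and `stub_prop52Irred`/`stub_coreVertexExistenceIrred` ↦ the PRIMED `…P` forms of 20165 v5 (plan g22 `…v5_primedSigs.lean`, bridge re-issue p521540, K9 twin p522249). `WildJetchevBoundAtP_of` is a REAL proof; `lean check`: sorries ONLY in `stub_*` (7 = stubs_max; 6 after the `d_K ≠ −4` restatement).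
HONEST FRAMING: conditional throughout; nothing booked; the crux, its stubs and BSD are as open as before.

References: [cite: Jetchev2008, Conj. 1.3, Thm. 1.4, Cor. 1.5, Lemma 4.3, Def. 4.8, Prop. 4.9, Thm. 5.1, Thm. 5.2 (p. 821), Prop. 5.3, Rem. 6.2]
[cite: MatarNekovar2019, Thm. 0.7, §0.11] [cite: McCallumLMS1991, §3 Cor. 3.2, §4 Prop. 4.4, §5 Prop. 5.2, Lemma 5.1, Cor. 5.6]
[cite: GrossLMS1991, §3, Prop. 5.3, Prop. 6.2 (1)] [cite: GrossZagier1986, III (3.1)] [cite: MilneADT2006, I Prop. 3.8]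
-/

set_option linter.dupNamespace false
set_option autoImplicit false

noncomputable section

open scoped Classical NumberField

open WeierstrassCurve IsDedekindDomain NumberField Literature.NumberTheory.EllipticCurves
  Literature.NumberTheory.EllipticCurves.ModularForms Literature.NumberTheory.EllipticCurves.Jetchev2008
  Literature.NumberTheory.EllipticCurves.Rank1Residual
  Literature.NumberTheory.GaloisRepresentations
  Literature.NumberTheory.GaloisRepresentations.DiscreteGaloisModule
  Summit.BirchSwinnertonDyer.Rank1Residual Summit.BirchSwinnertonDyer.Rank1Residual.X11b
  Summit.BirchSwinnertonDyer.Rank1Residual.JET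
  Summit.BirchSwinnertonDyer.BirchSwinnertonDyer.Theorems

namespace Summit.BirchSwinnertonDyer.BirchSwinnertonDyer.Cruxes.WildJetchevBoundAtP.BirthV3

/-- Statement of `stub_structureIrred` (S1): Kolyvagin's structure theorem, UPPER half, under IRREDUCIBILITY of
`E[p]`, with NO reduction-type binder at `p` (McCallum currency): `ord_p #Ш(E/K)[p^∞] + 2t ≤ 2M₀`
(`p^{M₀} ∥ y_K` in `E(K)`) when every derived Heegner point is `p^s`-divisible at every depth `s ≤ t`.
= `Cha2005.rmk25_padicValNat_card_sha_primary_add_le_of_globalDivisibility` minus `p ∤ d_K`, `p² ∤ N`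
(Matar–Nekovář 2019 Thm. 0.7 + §0.11; McCallum 1991 Cor. 5.6). -/
abbrev Sig.stub_structureIrred : Prop :=
  ∀ (W : WeierstrassCurve ℚ) [W.IsElliptic] [W.IsGloballyMinimal] [NeZero (W.conductorNorm ℤ)],
    ¬ W.HasCM →
    ∀ (K : Type) [Field K] [NumberField K], IsImaginaryQuadratic K →
    NumberField.discr K ≠ -3 → NumberField.discr K ≠ -4 →
    SatisfiesHeegnerHypothesis (W.conductorNorm ℤ) K →
    ∀ (p : ℕ) [Fact p.Prime], p ≠ 2 → W.HasIrreducibleModPGaloisRep p →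
    ∀ (Dt : ModularParametrizationData W (W.conductorNorm ℤ)) (β : ℤ) (ι : K →+* ℂ)
      (d₁ : KolyvaginHeegnerData Dt β ι 1) (P : (W.baseChange K).toAffine.Point),
      d₁.toGeomPoints d₁.derivedPoint = toGeomPoints (W.baseChange K) P →
      ¬ IsOfFinAddOrder P →
    ∀ (M₀ : ℕ),
      (∃ Q : (W.baseChange K).toAffine.Point, ((p ^ M₀ : ℕ) : ℤ) • Q = P) →
      (¬ ∃ Q : (W.baseChange K).toAffine.Point, ((p ^ (M₀ + 1) : ℕ) : ℤ) • Q = P) →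
    ∀ (t : ℕ),
      (∀ (s : ℕ), s ≤ t → ∀ (n : ℕ) (d : KolyvaginHeegnerData Dt β ι n), Squarefree n →
        (∀ ℓ ∈ n.primeFactors, Zhang2014.IsKolyvaginPrime (W.conductorNorm ℤ) W K p ℓ ∧
          s ≤ Zhang2014.kolyvaginIndex W p ℓ) →
        ∃ Q : (W.baseChange (ringClassField K ι n)).toAffine.Point,
          ((p ^ s : ℕ) : ℤ) • Q = d.derivedPoint) →
    padicValNat p (Nat.card (AddCommGroup.primaryComponent (W.baseChange K).sha p)) + 2 * t ≤ 2 * M₀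

/-- Statement of `stub_prop52Irred`: McCallum 1991 Prop. 5.2 («`M_r < M ⟹ ∃ c ∈ Λ^r_M` with `ord P(c)` of exact order `p^{M−M_r}`») in the IRREDUCIBLE reading — the `p`-adic-tower / surjectivity binder replaced by `W.HasIrreducibleModPGaloisRep p` (valid under absolute irreducibility by Jetchev 2008 Rem. 6.2: the proof uses the image only through the Čebotarev Cor. 3.2). VERBATIM the hypothesis `h52I` of `divisibilityIrredAddv_of_prop52Irred_of_coreVertexExistenceIrred_of_thm63` (p504855). A READING, displayed, nothing asserted. [cite: McCallumLMS1991, §5 Prop. 5.2 (p. 304), §3 Cor. 3.2] [cite: Jetchev2008, Rem. 6.2] -/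
abbrev Sig.stub_prop52IrredP : Prop :=
   ∀ (W : WeierstrassCurve ℚ) [W.IsElliptic] [W.IsGloballyMinimal] [NeZero (W.conductorNorm ℤ)],
      ¬ W.HasCM →
      ∀ (K : Type) [Field K] [NumberField K], IsImaginaryQuadratic K →
      NumberField.discr K ≠ -3 → NumberField.discr K ≠ -4 →
      SatisfiesHeegnerHypothesis (W.conductorNorm ℤ) K →
      ∀ (p : ℕ) [Fact p.Prime], p ≠ 2 → W.HasIrreducibleModPGaloisRep p → (p : ℤ) ∣ W.conductorNorm ℤ →
      ∀ (Dt : ModularParametrizationData W (W.conductorNorm ℤ)) (β : ℤ) (ι : K →+* ℂ)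
        (d₁ : KolyvaginHeegnerData Dt β ι 1), ¬ IsOfFinAddOrder d₁.derivedPoint →
      ∀ (r : ℕ), 0 < r →
      ∀ (Mr : ℕ),
        IsLeast {u : ℕ | ∃ (n : ℕ) (d : KolyvaginHeegnerData Dt β ι n), Squarefree n ∧
            n.primeFactors.card = r ∧
            (∀ ℓ ∈ n.primeFactors, Zhang2014.IsKolyvaginPrime (W.conductorNorm ℤ) W K p ℓ ∧
              u + 1 ≤ Zhang2014.kolyvaginIndex W p ℓ) ∧
            (∃ Q : (W.baseChange (ringClassField K ι n)).toAffine.Point,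
              ((p ^ u : ℕ) : ℤ) • Q = d.derivedPoint) ∧
            ¬ ∃ Q : (W.baseChange (ringClassField K ι n)).toAffine.Point,
              ((p ^ (u + 1) : ℕ) : ℤ) • Q = d.derivedPoint} Mr →
      ∀ (M : ℕ), Mr < M →
        ∃ (n : ℕ) (d : KolyvaginHeegnerData Dt β ι n), Squarefree n ∧ n.primeFactors.card = r ∧
          (∀ ℓ ∈ n.primeFactors, Zhang2014.IsKolyvaginPrime (W.conductorNorm ℤ) W K p ℓ ∧
            M ≤ Zhang2014.kolyvaginIndex W p ℓ) ∧
          addOrderOf (d.kolyvaginClass (Fact.out : p.Prime) M) = p ^ (M - Mr) ∧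
          (∃ Q : (W.baseChange (ringClassField K ι n)).toAffine.Point,
            ((p ^ Mr : ℕ) : ℤ) • Q = d.derivedPoint) ∧
          ¬ ∃ Q : (W.baseChange (ringClassField K ι n)).toAffine.Point,
            ((p ^ (Mr + 1) : ℕ) : ℤ) • Q = d.derivedPoint

/-- Statement of `stub_coreVertexExistenceIrred`: Jetchev 2008 Prop. 5.3 (= arXiv:math/0703431 Prop. 6.4: a core vertex of every level `m ≥ 1` above a conductor with non-torsion, exactly-`p^s`-divisible derived point and `s + m ≤ M(c)`) in the IRREDUCIBLE reading — bsd-jet's reading binder `JET.JetchevCoreVertexExistence` with its tower binder replaced by `W.HasIrreducibleModPGaloisRep p`. VERBATIM the hypothesis `hCVI` of p504855. A READING, displayed, nothing asserted. [cite: Jetchev2008, Prop. 5.3 (p. 823), Lemma 5.1, Rem. 6.2] -/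
abbrev Sig.stub_coreVertexExistenceIrredP : Prop :=
   ∀ (W : WeierstrassCurve ℚ) [W.IsElliptic] [W.IsGloballyMinimal] [NeZero (W.conductorNorm ℤ)],
      ¬ W.HasCM →
      ∀ (K : Type) [Field K] [NumberField K], IsImaginaryQuadratic K →
      NumberField.discr K ≠ -3 → NumberField.discr K ≠ -4 →
      SatisfiesHeegnerHypothesis (W.conductorNorm ℤ) K →
      ∀ (τ : K ≃ₐ[ℚ] K), τ ≠ 1 →
      ∀ (p : ℕ) [Fact p.Prime], p ≠ 2 → W.HasIrreducibleModPGaloisRep p → (p : ℤ) ∣ W.conductorNorm ℤ →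
      ∀ (Dt : ModularParametrizationData W (W.conductorNorm ℤ)) (β : ℤ) (ι : K →+* ℂ)
        [∀ k : ℕ, NumberField (ringClassField K ι k)]
        (d₁ : KolyvaginHeegnerData Dt β ι 1), ¬ IsOfFinAddOrder d₁.derivedPoint →
      ∀ (m : ℕ), 1 ≤ m →
      ∀ (c : ℕ) (d : KolyvaginHeegnerData Dt β ι c), Squarefree c →
        (∀ ℓ ∈ c.primeFactors, Zhang2014.IsKolyvaginPrime (W.conductorNorm ℤ) W K p ℓ) →
      ∀ (s : ℕ), ¬ IsOfFinAddOrder d.derivedPoint →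
        (∃ Q : (W.baseChange (ringClassField K ι c)).toAffine.Point,
          ((p ^ s : ℕ) : ℤ) • Q = d.derivedPoint) →
        (¬ ∃ Q : (W.baseChange (ringClassField K ι c)).toAffine.Point,
          ((p ^ (s + 1) : ℕ) : ℤ) • Q = d.derivedPoint) →
        ((s + m : ℕ) : ℕ∞) ≤ Zhang2014.levelIndex W p c →
        ∃ (c' : ℕ) (d' : KolyvaginHeegnerData Dt β ι c'), Squarefree c' ∧
          (∀ ℓ ∈ c'.primeFactors, Zhang2014.IsKolyvaginPrime (W.conductorNorm ℤ) W K p ℓ ∧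
            m + s ≤ Zhang2014.kolyvaginIndex W p ℓ) ∧
          Jetchev2008.IsGlobalCoreVertex W K ι τ p m c' ∧
          ¬ IsOfFinAddOrder d'.derivedPoint ∧
          ¬ ∃ Q : (W.baseChange (ringClassField K ι c')).toAffine.Point,
            ((p ^ (s + 1) : ℕ) : ℤ) • Q = d'.derivedPoint

/-- Statement of `stub_prop44Irred` (NEW in v3; = the hypothesis `h44I` of p508713 VERBATIM): McCallum 1991 Prop. 4.4
— at a place `λ ∣ ℓ` of `K`, for compatible Kolyvagin–Heegner data of conductors `m` and `mℓ` (all prime factors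
Kolyvagin of index `≥ M`), the `p^j`-multiples of the Kolyvagin class at `mℓ` lie in the Selmer local condition at `λ`
iff in the torsion local kernel, iff the same holds for the class at `m` — read with `E[p]` irreducible in place of
surjectivity. WHY IT MIGHT FAIL: expected to be an image-free port of McCallum §4, but the additive place `p ∣ N` and
the ring-class-field ramification at `ℓ` have not been checked in this reading by anyone.
[cite: McCallumLMS1991, §4 Prop. 4.4] [cite: Jetchev2008, Prop. 4.4, Rem. 6.2] -/
abbrev Sig.stub_prop44Irred : Prop :=
  ∀ (W : WeierstrassCurve ℚ) [W.IsElliptic] [W.IsGloballyMinimal] [NeZero (W.conductorNorm ℤ)],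
        ¬ W.HasCM →
        ∀ (K : Type) [Field K] [NumberField K], IsImaginaryQuadratic K →
        NumberField.discr K ≠ -3 → NumberField.discr K ≠ -4 →
        SatisfiesHeegnerHypothesis (W.conductorNorm ℤ) K →
        ∀ (p : ℕ) [Fact p.Prime], p ≠ 2 → W.HasIrreducibleModPGaloisRep p →
        ∀ (Dt : ModularParametrizationData W (W.conductorNorm ℤ)) (β : ℤ) (ι : K →+* ℂ)
          (M : ℕ), 1 ≤ M →
        ∀ (m l : ℕ), Squarefree (m * l) → l.Prime → ¬ l ∣ m →
          (∀ l' ∈ (m * l).primeFactors, Zhang2014.IsKolyvaginPrime (W.conductorNorm ℤ) W K p l' ∧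
            M ≤ Zhang2014.kolyvaginIndex W p l') →
        ∀ (d : KolyvaginHeegnerData Dt β ι m) (d' : KolyvaginHeegnerData Dt β ι (m * l)),
          (∀ l' ∈ m.primeFactors, ∀ (x : ringClassField K ι m) (x' : ringClassField K ι (m * l)),
            (x : ℂ) = x' → ((d'.σ l' x' : ringClassField K ι (m * l)) : ℂ) = (d.σ l' x : ℂ)) →
          (∀ s ∈ d.S, ∃ s' ∈ d'.S, ∀ (x : ringClassField K ι m) (x' : ringClassField K ι (m * l)),
            (x : ℂ) = x' → ((s' x' : ringClassField K ι (m * l)) : ℂ) = (s x : ℂ)) →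
          (∀ s' ∈ d'.S, ∃ s ∈ d.S, ∀ (x : ringClassField K ι m) (x' : ringClassField K ι (m * l)),
            (x : ℂ) = x' → ((s' x' : ringClassField K ι (m * l)) : ℂ) = (s x : ℂ)) →
          (∀ (x : ringClassField K ι m) (x' : ringClassField K ι (m * l)),
            (x : ℂ) = x' → d'.emb x' = d.emb x) →
        ∀ (v : HeightOneSpectrum (𝓞 K)), (l : 𝓞 K) ∈ v.asIdeal →
        ∀ (j : ℕ),
          (((p ^ j : ℕ) : ℤ) • d'.kolyvaginClass (Fact.out : p.Prime) M ∈
              selmerLocalKer (W.baseChange K) (v.adicCompletion K) ((p ^ M : ℕ) : ℤ) ↔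
            ((p ^ j : ℕ) : ℤ) • d'.kolyvaginClass (Fact.out : p.Prime) M ∈
              (W.baseChange K).torsionLocalKer (v.adicCompletion K) ((p ^ M : ℕ) : ℤ)) ∧
          (((p ^ j : ℕ) : ℤ) • d'.kolyvaginClass (Fact.out : p.Prime) M ∈
              (W.baseChange K).torsionLocalKer (v.adicCompletion K) ((p ^ M : ℕ) : ℤ) ↔
            ((p ^ j : ℕ) : ℤ) • d.kolyvaginClass (Fact.out : p.Prime) M ∈
              (W.baseChange K).torsionLocalKer (v.adicCompletion K) ((p ^ M : ℕ) : ℤ))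

/-- Statement of `stub_thm52KernelGapsAtP` (NEW, the ONE 19941-specific stub; = the hypothesis `hKGp` of
`WildJetchevBoundAtPCoreVertexBridge.thm63AtP_of_cor32Irred_of_prop44Irred_of_kernelGapsAtP`, p520230, VERBATIM up to
`open`s): 20165 v3's `stub_thm52KernelGapsAddv` with the Tamagawa CARRIER MOVED TO THE ADDITIVE PRIME `p` — same row
objects (non-CM `W`, Heegner field with `d_K ∉ {−3,−4}`, `τ ≠ 1`, odd additive potentially good `p`, `E[p]`
irreducible, frame `(Dt, β, ι)` with non-torsion `P_1`, depth functions `mdiv`/`m`, `m_∞`, a core vertex `c` of level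
`k > max(ord_p c_p, m_∞)`), plus the crux's row binders (`r_an = 0`, tower not onto, lattice-optimal datum with
`p ∤ c`), WITHOUT `q`, WITHOUT `p ∤ c_p`, WITHOUT the global Tamagawa binder: the named print (Gross §3 CM facts,
Prop. 5.3 sign, [GZ86 III (3.1)] receptacle form with `n′` prime to `p`) holds AND there exist Selmer structures
`𝒯` (transverse at the primes of `c`), `𝒮 ≤` Kummer (intended: the CONNECTED Kummer condition `im E⁰(K_v)` at the
places `Qcar` over `p`), `Qcar` disjoint from `c`, `e′ = ε(−1)^r`, `C′ ≤` the `−e′` part, with the five kernel gaps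
`htr`, `hdual_q` (Poitou–Tate count, `#Q′ = p^{ord_p c_p}` — local length `#Φ_v(𝔽_p)[p^∞]`, `= 3` on Kodaira IV/IV*),
`h49str` (Prop. 4.9 at `v ∣ p`: x11b3's `localKummerMap_mem_connectedKummerCondition_of_cocycle_of_hasAdditiveReduction`
mod [GZ III (3.1)]), `h49tr`, `hdual_ℓ`. In the TOWER case bsd-jet's K4 end form
(`JET.jetchevDivisibilityCarrierAdd_of_localFacts`) discharges exactly these from `hPT`/`hloc`/`h𝒯σ`/`h𝒯sd`/`hΦ`/`htr`/
`h49str`. WHY IT MIGHT FAIL: as 20165's gaps stub (Poitou–Tate for the tree's Selmer structures and the sign parts is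
typed but unproved; `h49str` at `v ∣ p` needs [GZ III (3.1)] at `p² ∣ N`); content only at `p = 3` (else `ord_p c_p
= 0` and `𝒮 :=` Kummer, `Qcar := ∅` make it trivial). SOURCES: Jetchev2008 Def 4.8, Prop 4.9, Thm 5.1, Lemma 5.2,
Thm 6.3; GrossLMS1991 §3, Prop 5.3, 6.2 (1); GrossZagier1986 III (3.1); MilneADT2006 I.3.8. -/
abbrev Sig.stub_thm52KernelGapsAtP : Prop :=
   ∀ (W : WeierstrassCurve ℚ) [W.IsElliptic] [W.IsGloballyMinimal] [NeZero (W.conductorNorm ℤ)],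
    ¬ W.HasCM → ∀ (K : Type) [Field K] [NumberField K], IsImaginaryQuadratic K →
    NumberField.discr K ≠ -3 → NumberField.discr K ≠ -4 →
    SatisfiesHeegnerHypothesis (W.conductorNorm ℤ) K →
    ∀ (τ : K ≃ₐ[ℚ] K), τ ≠ 1 →
    ∀ (p : ℕ) [Fact p.Prime], p ≠ 2 → W.analyticRank = 0 → Rank1Residual.Addv W p → 0 ≤ padicValRat p W.j →
    W.HasIrreducibleModPGaloisRep p → ¬ (∀ n : ℕ, W.HasSurjectiveModNGaloisRep (p ^ n : ℕ)) →
    (∃ Dt : ModularParametrizationData W (W.conductorNorm ℤ),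
      (∀ z ∈ Dt.L.lattice, ∃ w ∈ periodLattice Dt.f, z = (Dt.c : ℂ) * w) ∧ ¬ (p : ℤ) ∣ Dt.c) →
    ∀ (Dt : ModularParametrizationData W (W.conductorNorm ℤ)) (β : ℤ) (ι : K →+* ℂ)
      [∀ k : ℕ, NumberField (ringClassField K ι k)]
      (d₁ : KolyvaginHeegnerData Dt β ι 1), ¬ IsOfFinAddOrder d₁.derivedPoint →
    ∀ (mdiv m : {c : ℕ // Squarefree c ∧ ∀ ℓ ∈ c.primeFactors,
        Zhang2014.IsKolyvaginPrime (W.conductorNorm ℤ) W K p ℓ} → ℕ∞),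
    (∀ c (u : ℕ), (u : ℕ∞) ≤ mdiv c ↔ ∀ d : KolyvaginHeegnerData Dt β ι c.1,
      ∃ Q : (W.baseChange (ringClassField K ι c.1)).toAffine.Point,
        ((p ^ u : ℕ) : ℤ) • Q = d.derivedPoint) →
    (∀ c, m c = if mdiv c < Zhang2014.levelIndex W p c.1 then mdiv c else ⊤) →
    ∀ mInf : ℕ, (∀ c, (mInf : ℕ∞) ≤ m c) →
      (∀ m' : ℕ, ∃ c, (m' : ℕ∞) ≤ Zhang2014.levelIndex W p c.1 ∧ m c = mInf) →
    ∀ (k : ℕ) c, 1 ≤ k → Jetchev2008.IsGlobalCoreVertex W K ι τ p k c.1 → m c = mInf →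
      (k : ℕ∞) + mInf ≤ Zhang2014.levelIndex W p c.1 →
      padicValNat p ((W.baseChange ℚ_[p]).localTamagawaNumber ℤ_[p]) < k → mInf < k →
      (phi_heegnerPointOfConductor_mem_range_map_ringClassField (W.conductorNorm ℤ) W K ∧
      exists_generator_ringClassGalOver K ∧
      ∃ (ε : ℤ), (ε = 1 ∨ ε = -1) ∧
        (∀ (m : ℕ) (dm : KolyvaginHeegnerData Dt β ι m)
          (τm : ringClassField K ι m ≃ₐ[ℚ] ringClassField K ι m),
          (∀ x : ringClassField K ι m, ((τm x : ringClassField K ι m) : ℂ) = starRingEnd ℂ x) →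
          ∃ σ' ∈ ringClassGal ι m, IsOfFinAddOrder
          (pointGalHom W (ringClassField K ι m) τm dm.y -
          ε • pointGalHom W (ringClassField K ι m) σ' dm.y)) ∧
        ∃ (n' : ℤ), IsCoprime (p : ℤ) n' ∧
        (∀ (m : ℕ) (dm : KolyvaginHeegnerData Dt β ι m)
          (γ : ringClassField K ι m ≃ₐ[ℚ] ringClassField K ι m), γ ∈ ringClassGal ι m →
          ∀ v : HeightOneSpectrum (𝓞 K), ¬ (W.baseChange K).HasGoodReductionAt v →
          n' • pointsMap (W.baseChange K) (v.adicCompletion K)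
          (dm.toGeomPoints (pointGalHom W (ringClassField K ι m) γ dm.y)) ∈
          E0Receptacle (W.baseChange K) v ∧
          ∀ (ℓ : ℕ), ℓ ∈ m.primeFactors → ∀ (dm' : KolyvaginHeegnerData Dt β ι (m / ℓ))
          (hle : ringClassField K ι (m / ℓ) ≤ ringClassField K ι m),
          n' • pointsMap (W.baseChange K) (v.adicCompletion K)
          (dm.toGeomPoints (pointGalHom W (ringClassField K ι m) γ
          (WeierstrassCurve.Affine.Point.map (W' := W)
          ((RingClassField.inclusion ι hle).restrictScalars ℚ) dm'.y))) ∈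
          E0Receptacle (W.baseChange K) v) ∧
        ∃ (𝒯 𝒮 : SelmerStructure ((W.baseChange K).torsionGaloisModule ((p ^ k : ℕ) : ℤ)))
          (Qcar : Finset (HeightOneSpectrum (𝓞 K))) (e' : ℤ)
          (C' : AddSubgroup (galH1Torsion (W.baseChange K) ((p ^ k : ℕ) : ℤ))),
          (∀ x : galoisCohomology ((W.baseChange K).torsionGaloisModule ((p ^ k : ℕ) : ℤ)) 1,
            (∀ w ∈ placesDividing K c.1,
            galoisCohomology.localization ((W.baseChange K).torsionGaloisModule ((p ^ k : ℕ) : ℤ))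
            (Sum.inr w) 1 x ∈ 𝒯 (Sum.inr w)) ↔
            ∀ ℓ ∈ c.1.primeFactors, x ∈ transverseKer W K ι ((p ^ k : ℕ) : ℤ) ℓ) ∧
          (∀ v, 𝒮 v ≤ (W.baseChange K).kummerSelmerStructure ((p ^ k : ℕ) : ℤ) v) ∧
          Disjoint Qcar (placesDividing K c.1) ∧
          e' = ε * (-1) ^ c.1.primeFactors.card ∧
          C' ≤ signPart W K τ ((p ^ k : ℕ) : ℤ) (-e') ⊤ ∧
          (∀ (d : KolyvaginHeegnerData Dt β ι c.1), ∀ ℓ ∈ c.1.primeFactors,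
            (d.kolyvaginClass (Fact.out : p.Prime) k :
            galoisCohomology ((W.baseChange K).torsionGaloisModule ((p ^ k : ℕ) : ℤ)) 1) ∈
            transverseKer W K ι ((p ^ k : ℕ) : ℤ) ℓ) ∧
          (∃ (Qg Qg' : Type) (_ : AddCommGroup Qg) (_ : AddCommGroup Qg') (_ : Finite Qg')
            (locq : signPart W K τ ((p ^ k : ℕ) : ℤ) (-e')
            (modifiedSelmerGroup W K ι ((p ^ k : ℕ) : ℤ) c.1) →+ Qg)
            (locq' : C' →+ Qg'),
            (∀ x : C', locq' x = 0 ↔ (x : galH1Torsion (W.baseChange K) ((p ^ k : ℕ) : ℤ)) ∈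
            signPart W K τ ((p ^ k : ℕ) : ℤ) (-e') (modifiedSelmerGroup W K ι ((p ^ k : ℕ) : ℤ) c.1)) ∧
            Nat.card locq.range * Nat.card locq'.range = Nat.card Qg' ∧ IsAddCyclic Qg' ∧ Nat.card Qg' = p ^ padicValNat p ((W.baseChange ℚ_[p]).localTamagawaNumber ℤ_[p])) ∧
          (∀ (ℓ : ℕ), Zhang2014.IsKolyvaginPrime (W.conductorNorm ℤ) W K p ℓ →
            k ≤ Zhang2014.kolyvaginIndex W p ℓ → ℓ ∉ c.1.primeFactors →
            ∀ (d' : KolyvaginHeegnerData Dt β ι (c.1 * ℓ)), ∀ q ∈ Qcar,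
            galoisCohomology.localization ((W.baseChange K).torsionGaloisModule ((p ^ k : ℕ) : ℤ))
            (Sum.inr q) 1 (d'.kolyvaginClass (Fact.out : p.Prime) k) ∈ 𝒮 (Sum.inr q)) ∧
          (∀ (ℓ : ℕ), Zhang2014.IsKolyvaginPrime (W.conductorNorm ℤ) W K p ℓ →
            k ≤ Zhang2014.kolyvaginIndex W p ℓ → ℓ ∉ c.1.primeFactors →
            ∀ (d' : KolyvaginHeegnerData Dt β ι (c.1 * ℓ)), ∀ w ∈ placesDividing K c.1,
            galoisCohomology.localization ((W.baseChange K).torsionGaloisModule ((p ^ k : ℕ) : ℤ))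
            (Sum.inr w) 1 (d'.kolyvaginClass (Fact.out : p.Prime) k) ∈ 𝒯 (Sum.inr w)) ∧
          (∀ (ℓ : ℕ), Zhang2014.IsKolyvaginPrime (W.conductorNorm ℤ) W K p ℓ →
            k ≤ Zhang2014.kolyvaginIndex W p ℓ → ℓ ∉ c.1.primeFactors →
            ∀ (v : HeightOneSpectrum (𝓞 K)), (ℓ : 𝓞 K) ∈ v.asIdeal →
            ∃ (Sg : Type) (_ : AddCommGroup Sg)
            (sing : signPart W K τ ((p ^ k : ℕ) : ℤ) (-e')
            (((selmerF0 W ((p ^ k : ℕ) : ℤ) 𝒯 𝒮 (placesDividing K c.1) Qcar).relaxedAt {v}).selmerGroup) →+ Sg),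
            (∀ x, sing x = 0 ↔ (x : galoisCohomology ((W.baseChange K).torsionGaloisModule ((p ^ k : ℕ) : ℤ)) 1) ∈
            signPart W K τ ((p ^ k : ℕ) : ℤ) (-e')
            ((selmerF0 W ((p ^ k : ℕ) : ℤ) 𝒯 𝒮 (placesDividing K c.1) Qcar).selmerGroup)) ∧
            Nat.card sing.range *
            Nat.card (C'.map (galoisCohomology.localization
            ((W.baseChange K).torsionGaloisModule ((p ^ k : ℕ) : ℤ)) (Sum.inr v) 1 :
            galH1Torsion (W.baseChange K) ((p ^ k : ℕ) : ℤ) →+ _)) = p ^ k))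
/-- S2p — at-`p` divisibility at conductor level (the `hDp` schema of p518161; PROVED below from four stubs, not a stub):
on a frame of level `N_E` whose conductor-`1` derived point has infinite order, every derived Heegner point `P_n` is
`p^s`-divisible in `E(K[n])` for all `s ≤ ord_p c_p(E)` — the `q = p` share of Jetchev's Conj. 1.3, irreducible reading
of bsd-jet's K4 `JET.JetchevDivisibilityCarrierAdd`. [cite: Jetchev2008, Conj. 1.3, Thm. 1.4] -/
abbrev Sig.S2pDivisibilityAtP : Prop :=
  ∀ (W : WeierstrassCurve ℚ) [W.IsElliptic] [W.IsGloballyMinimal] [NeZero (W.conductorNorm ℤ)],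
      ¬ W.HasCM →
      ∀ (K : Type) [Field K] [NumberField K], IsImaginaryQuadratic K →
      NumberField.discr K ≠ -3 → NumberField.discr K ≠ -4 →
      SatisfiesHeegnerHypothesis (W.conductorNorm ℤ) K →
      ∀ (p : ℕ) [Fact p.Prime], p ≠ 2 → W.analyticRank = 0 → Addv W p → 0 ≤ padicValRat p W.j →
      W.HasIrreducibleModPGaloisRep p → ¬ (∀ n : ℕ, W.HasSurjectiveModNGaloisRep (p ^ n : ℕ)) →
      (∃ Dt : ModularParametrizationData W (W.conductorNorm ℤ),
        (∀ z ∈ Dt.L.lattice, ∃ w ∈ periodLattice Dt.f, z = (Dt.c : ℂ) * w) ∧ ¬ (p : ℤ) ∣ Dt.c) →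
      ∀ (Dt : ModularParametrizationData W (W.conductorNorm ℤ)) (β : ℤ) (ι : K →+* ℂ)
        (d₁ : KolyvaginHeegnerData Dt β ι 1), ¬ IsOfFinAddOrder d₁.derivedPoint →
      ∀ (s : ℕ), s ≤ padicValNat p ((W.baseChange ℚ_[p]).localTamagawaNumber ℤ_[p]) →
      ∀ (n : ℕ) (d : KolyvaginHeegnerData Dt β ι n), Squarefree n →
        (∀ ℓ ∈ n.primeFactors, Zhang2014.IsKolyvaginPrime (W.conductorNorm ℤ) W K p ℓ ∧
          s ≤ Zhang2014.kolyvaginIndex W p ℓ) →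
        ∃ Q : (W.baseChange (ringClassField K ι n)).toAffine.Point,
          ((p ^ s : ℕ) : ℤ) • Q = d.derivedPoint

/-- Statement of `stub_gaussianSupplement` (idle for the route; DROP by restating the crux with `NumberField.discr K ≠ -4`):
the crux body at the Gaussian field `d_K = −4` — the instances S1 (MN19 Thm. 0.7, printed for `D_K ≠ −3, −4`) does not
cover and the J08 road never uses (`p ∣ N` split in `ℚ(i)` forces `p ≡ 1 (4)`, so `ord_p c_p = 0` there and the
content is the MN19 Thm. 0.3-type bound at `ℚ(i)`, Gross's `u_K = 2` normalisation). = `h4` of p518161 §3.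
[cite: MatarNekovar2019, Thm. 0.3, Thm. 0.7 (D_K ≠ −3, −4)] [cite: GrossLMS1991, §3 (u_K)] -/
abbrev Sig.stub_gaussianSupplement : Prop :=
  ∀ (N : ℕ) [NeZero N] (W : WeierstrassCurve ℚ) [W.IsElliptic] [W.IsGloballyMinimal]
    (K : Type) [Field K] [NumberField K],
    IsImaginaryQuadratic K → NumberField.discr K = -4 → SatisfiesHeegnerHypothesis N K →
    ∀ (p : ℕ) [Fact p.Prime], p ≠ 2 → W.analyticRank = 0 → Addv W p → 0 ≤ padicValRat p W.j →
    ¬ W.HasCM → W.HasIrreducibleModPGaloisRep p → ¬ (∀ n : ℕ, W.HasSurjectiveModNGaloisRep (p ^ n : ℕ)) →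
    (∃ Dt : ModularParametrizationData W N,
      (∀ z ∈ Dt.L.lattice, ∃ w ∈ periodLattice Dt.f, z = (Dt.c : ℂ) * w) ∧ ¬ (p : ℤ) ∣ Dt.c) →
    ∀ {P : (W.baseChange K).toAffine.Point}, IsHeegnerPoint N W K P → ¬ IsOfFinAddOrder P → p ∣ N →
    padicValNat p (Nat.card (AddCommGroup.primaryComponent (W.baseChange K).sha p)) +
        2 * padicValNat p ((W.baseChange ℚ_[p]).localTamagawaNumber ℤ_[p]) ≤
      2 * padicValNat p (AddSubgroup.zmultiples P).index

/-- Statement of `stub_publishedInputsHeegner` (cite; the K9 route's held conjunction, item 19914). -/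
abbrev Sig.stub_publishedInputsHeegner : Prop :=
  Summit.BirchSwinnertonDyer.BirchSwinnertonDyer.Theses.KatoDescentPotSupersingular.PublishedInputsHeegner


/-- S1 — registered stub of 20165 (shared verbatim). -/
theorem stub_structureIrred : Sig.stub_structureIrred := by
  sorry

/-- McCallum Prop. 5.2, irreducible reading, PRIMED (`p ∣ N_E`) — 20165 v5's stub (shared verbatim). -/
theorem stub_prop52IrredP : Sig.stub_prop52IrredP := by
  sorry

/-- Jetchev Prop. 5.3, irreducible reading, PRIMED (`p ∣ N_E`) — 20165 v5's stub (shared verbatim). -/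
theorem stub_coreVertexExistenceIrredP : Sig.stub_coreVertexExistenceIrredP := by
  sorry

/-- McCallum Prop. 4.4, irreducible reading — registered stub of 20165 (shared verbatim). -/
theorem stub_prop44Irred : Sig.stub_prop44Irred := by
  sorry

/-- [J] Thm. 5.2 kernel gaps with the carrier at `p` — the ONE new stub. -/
theorem stub_thm52KernelGapsAtP : Sig.stub_thm52KernelGapsAtP := by
  sorry

/-- The K9 route's held `PublishedInputsHeegner` (cite). -/
theorem stub_publishedInputsHeegner : Sig.stub_publishedInputsHeegner := by
  sorry

/-- The idle `d_K = −4` supplement (drop by restating the crux). -/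
theorem stub_gaussianSupplement : Sig.stub_gaussianSupplement := by
  sorry

/-- **S2p (at-`p` divisibility at conductor level) is PROVED from four stubs** (p520230 §1 ∘ §2, `hRCF` discharged by
`JET.numberField_ringClassField`). A REAL proof. [cite: Jetchev2008, Thm. 1.4 (proof), Thm. 5.2, Prop. 5.3] -/
theorem S2pDivisibilityAtP_of (h52 : Sig.stub_prop52IrredP) (hCV : Sig.stub_coreVertexExistenceIrredP)
    (h44 : Sig.stub_prop44Irred) (hKG : Sig.stub_thm52KernelGapsAtP) :
    Sig.S2pDivisibilityAtP :=
  WildJetchevBoundAtPCoreVertexBridgePrimed.divisibilityAtP_of_prop52IrredP_of_coreVertexExistenceIrredP_of_thm63AtP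
    h52 hCV (fun K _ _ ι hK k ↦ Summit.BirchSwinnertonDyer.Rank1Residual.JET.numberField_ringClassField K hK ι k)
    (WildJetchevBoundAtPCoreVertexBridgePrimed.thm63AtP_of_prop44Irred_of_kernelGapsAtP h44 hKG)

/-- **The crux from the eight stubs** (p518161 §3 fed with S1, the proved S2p, PIH and the supplement), concluding the
K9 route decl BY NAME. A REAL proof; sorries only inside the stubs. [cite: Jetchev2008, Cor. 1.5 (p. 812)]
[cite: MatarNekovar2019, Thm. 0.7, §0.11] -/
theorem WildJetchevBoundAtP_of (hS : Sig.stub_structureIrred) (h52 : Sig.stub_prop52IrredP)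
    (hCV : Sig.stub_coreVertexExistenceIrredP) (h44 : Sig.stub_prop44Irred)
    (hKG : Sig.stub_thm52KernelGapsAtP) (hH : Sig.stub_publishedInputsHeegner) (h4 : Sig.stub_gaussianSupplement) :
    Summit.BirchSwinnertonDyer.BirchSwinnertonDyer.Theses.KatoDescentPotSupersingular.WildJetchevBoundAtP :=
  WildJetchevBoundAtPOfStubs.wildJetchevBoundAtP_of_structureIrred_of_divisibilityAtP_of_gaussianSupplement hS
    (S2pDivisibilityAtP_of h52 hCV h44 hKG) hH h4

/-- Sanity composition with the sorried stubs. -/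
theorem wildJetchevBoundAtP_of_stubs :
    Summit.BirchSwinnertonDyer.BirchSwinnertonDyer.Theses.KatoDescentPotSupersingular.WildJetchevBoundAtP :=
  WildJetchevBoundAtP_of stub_structureIrred stub_prop52IrredP stub_coreVertexExistenceIrredP stub_prop44Irred
    stub_thm52KernelGapsAtP stub_publishedInputsHeegner stub_gaussianSupplement

end Summit.BirchSwinnertonDyer.BirchSwinnertonDyer.Cruxes.WildJetchevBoundAtP.BirthV3

end
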